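import Summits.CriticalPhenomena.PercolationContinuityZ3.Theorems.PercNearOneGluingNoHeavyLowerTailKnQuestion8CoefficientwiseInGadgetCell
import Summits.CriticalPhenomena.PercolationContinuityZ3.Theorems.PercNearOneGluingNoHeavyLowerTailKnQuestion8CoefficientwiseStrata
import Summits.CriticalPhenomena.PercolationContinuityZ3.Theorems.PercNearOneGluingNoHeavyLowerTailKnQuestion8CoefficientwiseTopStratum
import HarnessLib

/-!
# CONJECTURE NO-CORE follows from the in-gadget inequality (IG) — prim-lf-2 gen 56

Support file (`--supports stmt-CriticalPhenomena-4575`, closed), prover `prim-lf-2` (gen 56).  No definitions, no named facts, no sorries; standard axioms.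
Memo `prim-lf-2/CW-DELCON-gen56.md` §7–8.  Companions: `…CoefficientwiseInGadgetCell.lean` (the cell lemma), `…CoefficientwiseStrata.lean` (`noCore_of_strata`),
`…CoefficientwiseTopStratum.lean` (`noCore_topStratum_nonneg`).

* `Coefficientwise.stratum_nonneg_of_inGadget` — every STRATUM of the root-set stratification,
  `M(S,q) = Σ_{s ⊆ E : y doubly joined to S ∪ {q} but not to S} (f(C_x s) − f(C_x(E∖s)))(g(C_x s) − g(C_x(E∖s)))`,
  is the sum of two cell sums of `inGadget_cell_nonneg` (with `S' = insert q S` and, after the colour swap, `S' = S`): the stratum event is the disjoint union of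
  `{y ∈ C_q(E∖s), S ∩ C_q(E∖s) = ∅, y red-joined to insert q S}` and the colour swap of `{y ∈ C_q(E∖s), S ∩ C_q(E∖s) = ∅, y red-joined to S}`.  Hence (IG) ⟹ `M(S,q) ≥ 0`.
* `Coefficientwise.noCore_of_inGadget` — **(IG) ⟹ CONJECTURE NO-CORE**: for finite `V`, if the in-gadget inequality holds for the pair `(f,g)`, the root `x`, the target `y` and all
  free/gadget edge sets inside `E` and all `S' ∋ x`, `y ∉ S'`, then `0 ≤ Σ_{s ⊆ E : ¬(y ∈ C_x s ∧ y ∈ C_x(E∖s))} (f(C_x s) − f(C_x(E∖s)))(g(C_x s) − g(C_x(E∖s)))`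
  (`noCore_of_strata` + `noCore_topStratum_nonneg`).  prim-lf-2 gen 56: (IG) is census-clean for all monotone pairs on ≤ 5 vertices (317 492 instances) and on 192 000 random
  6-vertex instances — it is the single remaining atom of CONJECTURE NO-CORE (gen 46).
[cite: KozmaNitzan2024, Questions 8–9 (§5.5 p. 36) (context: the Question-8 pocket covariance programme)]
-/

namespace Summit.CriticalPhenomena.PercolationContinuityZ3.Theorems

open Finset Literature.Probability.Percolation

namespace Coefficientwise

variable {ι V : Type*} [DecidableEq ι] [DecidableEq V]

open Classical in
/-- **Every stratum is a sum of two in-gadget cell sums; hence (IG) ⟹ `M(S,q) ≥ 0`.**  [cite: KozmaNitzan2024, Questions 8–9 (§5.5 p. 36) (context)] -/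
theorem stratum_nonneg_of_inGadget (ends : ι → Sym2 V) (E : Finset ι) (x y : V) (f g : Set V → ℝ)
    (hIG : ∀ (Ef Bg : Finset ι) (S' : Finset V), Ef ⊆ E → Bg ⊆ E → Disjoint Ef Bg → x ∈ S' → y ∉ S' → (∀ i ∈ Ef, y ∉ ends i) →
      0 ≤ ∑ r ∈ Ef.powerset.filter (fun r : Finset ι => ∃ a ∈ S', y ∈ openCluster (ends '' (↑(r ∪ Bg) : Set ι)) a),
        (f (openCluster (ends '' (↑(r ∪ Bg) : Set ι)) x) - f (openCluster (ends '' (↑(Ef \ r) : Set ι)) x)) *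
          (g (openCluster (ends '' (↑(r ∪ Bg) : Set ι)) x) - g (openCluster (ends '' (↑(Ef \ r) : Set ι)) x)))
    (S : Finset V) (hxS : x ∈ S) (hyS : y ∉ S) (q : V) (hqy : q ≠ y) :
    0 ≤ ∑ s ∈ E.powerset.filter (fun s : Finset ι =>
          ¬ ((∃ a ∈ S, y ∈ openCluster (ends '' (↑s : Set ι)) a) ∧ (∃ a ∈ S, y ∈ openCluster (ends '' (↑(E \ s) : Set ι)) a)) ∧
            ((∃ a ∈ insert q S, y ∈ openCluster (ends '' (↑s : Set ι)) a) ∧ (∃ a ∈ insert q S, y ∈ openCluster (ends '' (↑(E \ s) : Set ι)) a))),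
        (f (openCluster (ends '' (↑s : Set ι)) x) - f (openCluster (ends '' (↑(E \ s) : Set ι)) x)) *
          (g (openCluster (ends '' (↑s : Set ι)) x) - g (openCluster (ends '' (↑(E \ s) : Set ι)) x)) := by
  -- notation
  set K : Finset ι → Set V := fun s => openCluster (ends '' (↑s : Set ι)) x with hK
  set T : Finset ι → ℝ := fun s => (f (K s) - f (K (E \ s))) * (g (K s) - g (K (E \ s))) with hT
  set red : Finset V → Finset ι → Prop := fun S' s => ∃ a ∈ S', y ∈ openCluster (ends '' (↑s : Set ι)) a with hred
  set bq : Finset ι → Prop := fun s => y ∈ openCluster (ends '' (↑(E \ s) : Set ι)) q ∧ ∀ a ∈ S, a ∉ openCluster (ends '' (↑(E \ s) : Set ι)) q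
    with hbq
  set L : Finset ι → Prop := fun s => bq s ∧ red (insert q S) s with hL
  set L' : Finset ι → Prop := fun s => bq s ∧ red S s with hL'
  set Str : Finset ι → Prop := fun s => ¬ (red S s ∧ red S (E \ s)) ∧ (red (insert q S) s ∧ red (insert q S) (E \ s)) with hStr
  change 0 ≤ ∑ s ∈ E.powerset.filter Str, T s
  -- cluster facts
  have c1 : ∀ (t : Finset ι) (a : V), y ∈ openCluster (ends '' (↑t : Set ι)) q → y ∈ openCluster (ends '' (↑t : Set ι)) a →
      a ∈ openCluster (ends '' (↑t : Set ι)) q := fun t a hq ha => SimpleGraph.Reachable.trans hq (SimpleGraph.Reachable.symm ha)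
  have c2 : ∀ (t : Finset ι) (a : V), a ∈ openCluster (ends '' (↑t : Set ι)) q → y ∈ openCluster (ends '' (↑t : Set ι)) q →
      y ∈ openCluster (ends '' (↑t : Set ι)) a := fun t a ha hq => SimpleGraph.Reachable.trans (SimpleGraph.Reachable.symm ha) hq
  have hqins : q ∈ insert q S := Finset.mem_insert_self q S
  -- the stratum event is `L s ∨ L' (E ∖ s)`, exclusively
  have hiff : ∀ s, s ⊆ E → (Str s ↔ (L s ∨ L' (E \ s))) := by
    intro s hsE
    have hss : E \ (E \ s) = s := Finset.sdiff_sdiff_eq_self hsE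
    constructor
    · rintro ⟨hnd, ⟨a₁, ha₁, hy₁⟩, ⟨a₂, ha₂, hy₂⟩⟩
      by_cases hB : red S (E \ s)
      · -- then no red join to `S`: the red join to `insert q S` goes through `q`
        right
        have hnR : ¬ red S s := fun h => hnd ⟨h, hB⟩
        have ha₁q : a₁ = q := by
          rcases Finset.mem_insert.mp ha₁ with h | h
          · exact h
          · exact absurd ⟨a₁, h, hy₁⟩ hnR
        subst ha₁q
        refine ⟨?_, hB⟩
        show y ∈ openCluster (ends '' (↑(E \ (E \ s)) : Set ι)) a₁ ∧ ∀ a ∈ S, a ∉ openCluster (ends '' (↑(E \ (E \ s)) : Set ι)) a₁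
        rw [hss]
        exact ⟨hy₁, fun a haS haq => hnR ⟨a, haS, c2 s a haq hy₁⟩⟩
      · left
        have ha₂q : a₂ = q := by
          rcases Finset.mem_insert.mp ha₂ with h | h
          · exact h
          · exact absurd ⟨a₂, h, hy₂⟩ hB
        subst ha₂q
        exact ⟨⟨hy₂, fun a haS haq => hB ⟨a, haS, c2 _ a haq hy₂⟩⟩, ⟨a₁, ha₁, hy₁⟩⟩
    · rintro (⟨⟨hyq, hSq⟩, hR⟩ | ⟨⟨hyq, hSq⟩, hR⟩)
      · refine ⟨fun ⟨_, ⟨a, haS, hya⟩⟩ => hSq a haS (c1 _ a hyq hya), hR, ⟨q, hqins, hyq⟩⟩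
      · have hyq' : y ∈ openCluster (ends '' (↑s : Set ι)) q := by rw [← hss]; exact hyq
        have hSq' : ∀ a ∈ S, a ∉ openCluster (ends '' (↑s : Set ι)) q := by rw [← hss]; exact hSq
        refine ⟨fun ⟨⟨a, haS, hya⟩, _⟩ => hSq' a haS (c1 _ a hyq' hya), ⟨q, hqins, hyq'⟩, ?_⟩
        obtain ⟨a, haS, hya⟩ := hR
        exact ⟨a, Finset.mem_insert_of_mem haS, hya⟩
  have hexcl : ∀ s, s ⊆ E → ¬ (L s ∧ L' (E \ s)) := by
    intro s hsE ⟨⟨⟨hyq, hSq⟩, _⟩, ⟨_, ⟨a, haS, hya⟩⟩⟩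
    exact hSq a haS (c1 _ a hyq hya)
  -- split the sum
  have hsplit : ∑ s ∈ E.powerset.filter Str, T s = ∑ s ∈ E.powerset.filter L, T s + ∑ s ∈ E.powerset.filter (fun s => L' (E \ s)), T s := by
    rw [Finset.sum_filter, Finset.sum_filter, Finset.sum_filter, ← Finset.sum_add_distrib]
    refine Finset.sum_congr rfl fun s hs => ?_
    have hsE := Finset.mem_powerset.mp hs
    rw [if_congr (hiff s hsE) rfl rfl]
    by_cases h1 : L s <;> by_cases h2 : L' (E \ s)
    · exact absurd ⟨h1, h2⟩ (hexcl s hsE)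
    · rw [if_pos (Or.inl h1), if_pos h1, if_neg h2]; ring
    · rw [if_pos (Or.inr h2), if_neg h1, if_pos h2]; ring
    · rw [if_neg (fun h => h.elim h1 h2), if_neg h1, if_neg h2]; ring
  rw [hsplit]
  -- the swapped piece equals the cell sum for `L'`
  have hswap : ∑ s ∈ E.powerset.filter (fun s => L' (E \ s)), T s = ∑ s ∈ E.powerset.filter L', T s := by
    rw [Finset.sum_filter, Finset.sum_filter, ← sum_powerset_sdiff E (fun t => if L' t then T t else 0)]
    refine Finset.sum_congr rfl fun s hs => ?_
    have hss : E \ (E \ s) = s := Finset.sdiff_sdiff_eq_self (Finset.mem_powerset.mp hs)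
    refine if_congr Iff.rfl ?_ rfl
    simp only [hT, hss]; ring
  rw [hswap]
  have hyins : y ∉ insert q S := fun h => by
    rcases Finset.mem_insert.mp h with h | h
    · exact hqy h.symm
    · exact hyS h
  refine add_nonneg ?_ ?_
  · exact inGadget_cell_nonneg ends E x y q S (insert q S) hxS f g
      (fun Ef Bg hEf hBg hd hfree => hIG Ef Bg (insert q S) hEf hBg hd (Finset.mem_insert_of_mem hxS) hyins hfree)
  · exact inGadget_cell_nonneg ends E x y q S S hxS f g
      (fun Ef Bg hEf hBg hd hfree => hIG Ef Bg S hEf hBg hd hxS hyS hfree)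

open Classical in
/-- **(IG) ⟹ CONJECTURE NO-CORE.**  For a finite vertex type: if the in-gadget inequality holds for `(f, g)`, the root `x`, the target `y ≠ x`, all disjoint free/gadget edge sets
inside `E` with no free edge at `y`, and all vertex sets `S' ∋ x` with `y ∉ S'`, then the NO-CORE sum of `(E; x, y)` for `(f, g)` is nonnegative.
[cite: KozmaNitzan2024, Questions 8–9 (§5.5 p. 36) (context)] -/
theorem noCore_of_inGadget [Fintype V] (ends : ι → Sym2 V) (E : Finset ι) (x y : V) (hyx : y ≠ x) (f g : Set V → ℝ) (hf : Monotone f) (hg : Monotone g)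
    (hIG : ∀ (Ef Bg : Finset ι) (S' : Finset V), Ef ⊆ E → Bg ⊆ E → Disjoint Ef Bg → x ∈ S' → y ∉ S' → (∀ i ∈ Ef, y ∉ ends i) →
      0 ≤ ∑ r ∈ Ef.powerset.filter (fun r : Finset ι => ∃ a ∈ S', y ∈ openCluster (ends '' (↑(r ∪ Bg) : Set ι)) a),
        (f (openCluster (ends '' (↑(r ∪ Bg) : Set ι)) x) - f (openCluster (ends '' (↑(Ef \ r) : Set ι)) x)) *
          (g (openCluster (ends '' (↑(r ∪ Bg) : Set ι)) x) - g (openCluster (ends '' (↑(Ef \ r) : Set ι)) x))) :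
    0 ≤ ∑ s ∈ E.powerset.filter (fun s : Finset ι => ¬ (y ∈ openCluster (ends '' (↑s : Set ι)) x ∧
          y ∈ openCluster (ends '' (↑(E \ s) : Set ι)) x)),
      (f (openCluster (ends '' (↑s : Set ι)) x) - f (openCluster (ends '' (↑(E \ s) : Set ι)) x)) *
        (g (openCluster (ends '' (↑s : Set ι)) x) - g (openCluster (ends '' (↑(E \ s) : Set ι)) x)) :=
  noCore_of_strata ends E x y hyx f g
    (fun S hxS hyS q _ hqy => stratum_nonneg_of_inGadget ends E x y f g hIG S hxS hyS q hqy)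
    (by
      convert noCore_topStratum_nonneg ends E x y f g hf hg using 3
      simp only [Finset.mem_erase, Finset.mem_univ, and_true])

end Coefficientwise

end Summit.CriticalPhenomena.PercolationContinuityZ3.Theorems
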